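import Summits.KontsevichZagierPeriods.KontsevichZagierPeriods.Theses.HyperbolicBloch
import Literature.NumberTheory.Transcendental.KZHyperbolicLadder
import Literature.NumberTheory.Transcendental.KZCubicalCalculus
import Literature.NumberTheory.Transcendental.KZProduct
import Summits.KontsevichZagierPeriods.KontsevichZagierPeriods.Theorems.HyperbolicBlochOffTetraSectorKernelStubVPiece
import Summits.KontsevichZagierPeriods.KontsevichZagierPeriods.Theorems.HyperbolicBlochOffTetraSectorKernelRungTwo
import Summits.KontsevichZagierPeriods.KontsevichZagierPeriods.Theorems.HyperbolicBlochOffTetraSectorKernelStubKernelOfValueOne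
import Summits.KontsevichZagierPeriods.KontsevichZagierPeriods.Theorems.HyperbolicBlochOffTetraSectorKernelStubValueOneOfOrbit
import Summits.KontsevichZagierPeriods.KontsevichZagierPeriods.Theorems.HyperbolicBlochOffTetraSectorKernelStubCubeDensityTransfer
import Summits.KontsevichZagierPeriods.KontsevichZagierPeriods.Theorems.HyperbolicBlochOffTetraSectorKernelResidueForms
import Summits.KontsevichZagierPeriods.KontsevichZagierPeriods.Theorems.HyperbolicBlochOffTetraSectorKernelStubRungOneStd
import Summits.KontsevichZagierPeriods.KontsevichZagierPeriods.Theorems.HyperbolicBlochOffTetraSectorKernelStubStdFlatten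
import Summits.KontsevichZagierPeriods.KontsevichZagierPeriods.Theorems.HyperbolicBlochOffTetraSectorKernelStubArcWeierstrass
import Summits.KontsevichZagierPeriods.KontsevichZagierPeriods.Theorems.HyperbolicBlochOffTetraSectorKernelStubDiscClass
import Summits.KontsevichZagierPeriods.KontsevichZagierPeriods.Theorems.HyperbolicBlochOffTetraSectorKernelStubCornerSimplexClass
import Summits.KontsevichZagierPeriods.KontsevichZagierPeriods.Theorems.HyperbolicBlochOffTetraSectorKernelStubBakerEnvelope
import Summits.KontsevichZagierPeriods.KontsevichZagierPeriods.Theorems.DefinableMovesCircleSquaringImpossibleTransport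

/-!
# The weight-one envelope — crux `OffTetraSectorKernel` (stmt-KontsevichZagierPeriods-10557), line `odd-hyperbolic-ladder` (v7, lead c5)

**BAKER GLUES THE CLOSED SECTORS.** Leads c1 and c3 closed rung 0 (hyperbolic lengths: logarithms of algebraic numbers)
and rung 1 (hyperbolic areas: `ℤπ + Σ arccos ℚ̄`) of the hyperbolic scissors ladder separately and without transcendence
input; lead c4 closed the Euclidean affine sector. Here the WEIGHT-ONE ENVELOPE — the subgroup of `KZ.FormalRep` generated by
all rung-0 and rung-1 polytope representations, all algebraic affine images of the corner simplices `Δ_d` (Hilbert's third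
problem, every dimension) and of the unit disc (ellipses with algebraic data), and all rational representations of dimension
`≤ 1` — is shown to meet `ker eval` inside `KZ.relations` (`bakerEnvelope_inf_ker_le_relations`): a `ℤ`-relation MIXING
lengths, angles, algebraic volumes and `π`-areas is a Kontsevich–Zagier relation. The transcendence input is Baker's theorem,
PROVED in the tree (`Literature.NumberTheory.Transcendental.baker_holds`), through the mixed normal form of the
HurwitzMicroSectors `NormalFormPrinciple` line (`PiBox.Dlog.nfD_eq_zero_of_eval_eq_zero`); the moves are the six landed stubs
of skeleton v7 (`stub_rungOneStd`, `stub_stdFlatten`, `stub_arcWeierstrass`, `stub_cornerSimplexClass`, `stub_discClass`,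
`stub_bakerEnvelope`). Corollaries: hyperbolic lengths and areas glue (`rungZero_add_rungOne_mem_relations`, Gelfond–Schneider
inside Baker); `π` ACROSS GEOMETRIES (`disc_sub_idealTriangle_mem_relations`): Kontsevich–Zagier's first example, the unit
disc, is KZ-equivalent to the ideal hyperbolic triangle `(−1, 1, ∞)` — two generators of the envelope with the same value `π`. Finally the crux is EQUIVALENT to its v7 remainder (`offTetraSectorKernel_iff_moserModEnvelope`): the Moser form
of Conjecture 1 modulo the tetrahedral value-relators, the Bloch–Wigner rung, the weight-one envelope and the affine sector —
whose first open layer is named by two classical questions beyond Baker's (linear) theorem: `ℚ̄`-linear independence of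
Bloch–Wigner values from weight-one periods, and quadratic relations among logarithms.

References: A. Baker, *Transcendental Number Theory* (1975), Thm. 2.1; M. Kontsevich, D. Zagier, *Periods* (2001), §1.2;
J. L. Dupont, C.-H. Sah, *Scissors congruences II*, J. Pure Appl. Algebra 25 (1982).
-/

noncomputable section

open Set MeasureTheory
open Literature.NumberTheory.Transcendental

namespace Summit.KontsevichZagierPeriods.HyperbolicBloch.OffTetraSectorKernel

/-- **THE WEIGHT-ONE ENVELOPE IS ABSORBED BY `relations`**: on the subgroup generated by rung-0 and rung-1 polytope
representations of the hyperbolic ladder, algebraic affine images of corner simplices and of the unit disc (integrand `1`),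
and rational representations of dimension `≤ 1`, the kernel of `eval` consists of Kontsevich–Zagier relations (the six
landed stubs of skeleton v7; Baker's theorem glues the weight-one sectors). [cite: Baker1975, Theorem 2.1] -/
theorem bakerEnvelope_inf_ker_le_relations :
    KZ.eval.ker ⊓ AddSubgroup.closure
      ({y : KZ.FormalRep | ∃ r : KZ.IntegralRep 1, KZ.IsGeodesicPolytope 0 r.domain ∧
          EqOn r.integrand (KZ.hypDensity 0) r.domain ∧ y = KZ.of r} ∪
        {y | ∃ r : KZ.IntegralRep 2, KZ.IsGeodesicPolytope 1 r.domain ∧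
          EqOn r.integrand (KZ.hypDensity 1) r.domain ∧ y = KZ.of r} ∪
        {y | ∃ (d : ℕ) (A : Matrix (Fin d) (Fin d) ℝ) (b : Fin d → ℝ) (r : KZ.IntegralRep d),
          (∀ j l, IsAlgebraic ℚ (A j l)) ∧ (∀ j, IsAlgebraic ℚ (b j)) ∧ A.det ≠ 0 ∧
          r.domain = (fun x => A.mulVec x + b) '' {x | (∀ i, 0 < x i) ∧ ∑ i, x i < 1} ∧
          (∀ x ∈ r.domain, r.integrand x = 1) ∧ y = KZ.of r} ∪
        {y | ∃ (A : Matrix (Fin 2) (Fin 2) ℝ) (b : Fin 2 → ℝ) (r : KZ.IntegralRep 2),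
          (∀ j l, IsAlgebraic ℚ (A j l)) ∧ (∀ j, IsAlgebraic ℚ (b j)) ∧ A.det ≠ 0 ∧
          r.domain = (fun x => A.mulVec x + b) '' {p | p 0 ^ 2 + p 1 ^ 2 < 1} ∧
          (∀ x ∈ r.domain, r.integrand x = 1) ∧ y = KZ.of r} ∪
        {y | ∃ (m : ℕ) (N : KZ.IntegralRep m), m ≤ 1 ∧ N.IsRational ∧ y = KZ.of N}) ≤ KZ.relations :=
  fun x hx => stub_bakerEnvelope stub_rungOneStd stub_stdFlatten stub_arcWeierstrass stub_cornerSimplexClass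
    stub_discClass x (AddSubgroup.mem_inf.mp hx).2 (AddMonoidHom.mem_ker.mp (AddSubgroup.mem_inf.mp hx).1)

/-- **Hyperbolic lengths and hyperbolic areas glue**: a `ℤ`-relation mixing rung-0 polytope representations (values
`log(β/α)`) and rung-1 polytope representations (values in `ℤπ + Σ arccos ℚ̄`) is a Kontsevich–Zagier relation — the
Gelfond–Schneider instance of the envelope theorem. [cite: Baker1975, Theorem 2.1] -/
theorem rungZero_add_rungOne_mem_relations {c₀ c₁ : KZ.FormalRep}
    (h₀ : c₀ ∈ AddSubgroup.closure {y : KZ.FormalRep | ∃ r : KZ.IntegralRep 1, KZ.IsGeodesicPolytope 0 r.domain ∧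
          EqOn r.integrand (KZ.hypDensity 0) r.domain ∧ y = KZ.of r})
    (h₁ : c₁ ∈ AddSubgroup.closure {y : KZ.FormalRep | ∃ r : KZ.IntegralRep 2, KZ.IsGeodesicPolytope 1 r.domain ∧
          EqOn r.integrand (KZ.hypDensity 1) r.domain ∧ y = KZ.of r})
    (hv : KZ.eval (c₀ + c₁) = 0) : c₀ + c₁ ∈ KZ.relations := by
  refine bakerEnvelope_inf_ker_le_relations (AddSubgroup.mem_inf.mpr ⟨AddMonoidHom.mem_ker.mpr hv, add_mem ?_ ?_⟩)
  · refine AddSubgroup.closure_mono ?_ h₀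
    intro y hy
    exact Or.inl (Or.inl (Or.inl (Or.inl hy)))
  · refine AddSubgroup.closure_mono ?_ h₁
    intro y hy
    exact Or.inl (Or.inl (Or.inl (Or.inr hy)))

/-- **Mixed rung-0 / rung-1 value relators are relations** (the relator form of the previous corollary): for rung-0
polytope representations `rᵢ` and rung-1 polytope representations `sⱼ` with `Σ mᵢ vol rᵢ + Σ nⱼ area sⱼ = 0`,
`Σ mᵢ•[rᵢ] + Σ nⱼ•[sⱼ] ∈ KZ.relations`. [cite: Baker1975, Theorem 2.1] -/
theorem mixed_rungZero_rungOne_relator_mem_relations {k k' : ℕ} (r : Fin k → KZ.IntegralRep 1)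
    (s : Fin k' → KZ.IntegralRep 2) (m : Fin k → ℤ) (n : Fin k' → ℤ)
    (hr : ∀ i, KZ.IsGeodesicPolytope 0 (r i).domain ∧ EqOn (r i).integrand (KZ.hypDensity 0) (r i).domain)
    (hs : ∀ j, KZ.IsGeodesicPolytope 1 (s j).domain ∧ EqOn (s j).integrand (KZ.hypDensity 1) (s j).domain)
    (hval : ∑ i, (m i : ℝ) * (r i).value + ∑ j, (n j : ℝ) * (s j).value = 0) :
    ∑ i, m i • KZ.of (r i) + ∑ j, n j • KZ.of (s j) ∈ KZ.relations := by
  refine rungZero_add_rungOne_mem_relations ?_ ?_ ?_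
  · refine sum_mem fun i _ => AddSubgroup.zsmul_mem _ (AddSubgroup.subset_closure ?_) _
    exact ⟨r i, (hr i).1, (hr i).2, rfl⟩
  · refine sum_mem fun j _ => AddSubgroup.zsmul_mem _ (AddSubgroup.subset_closure ?_) _
    exact ⟨s j, (hs j).1, (hs j).2, rfl⟩
  · simp only [map_add, map_sum, map_zsmul, KZ.eval_of, zsmul_eq_mul]
    exact hval

/-! ## `π` across geometries: a concrete instance -/

/-- The value of an integrand-`1` representation on the open unit disc is `π`. [cite: KontsevichZagier2001, §1.1 eq. (1)] -/
theorem value_openDisc (D : KZ.IntegralRep 2) (hD : D.domain = {p | p 0 ^ 2 + p 1 ^ 2 < 1})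
    (hD1 : ∀ p ∈ D.domain, D.integrand p = 1) : D.value = Real.pi := by
  rw [D.value_eq_volume_real hD1, hD, measureReal_def,
    Summit.KontsevichZagierPeriods.DefinableMoves.CircleSquaring.volume_unitDisc, ENNReal.toReal_ofReal Real.pi_pos.le]

/-- The ideal triangle `{−1 < x < 1, t > 0, x² + t² > 1}` is a `ℚ̄`-geodesic polygon of `ℍ²` (two vertical sides and one
semicircle) of finite area. [cite: KontsevichZagier2001, §1.1] -/
theorem isGeodesicPolytope_idealTriangle (S : KZ.IntegralRep 2)
    (hS : S.domain = {p | -1 < p 0 ∧ p 0 < 1 ∧ 0 < p 1 ∧ 1 < (p 0 - 0) ^ 2 + p 1 ^ 2})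
    (hSi : EqOn S.integrand (fun p => 1 / p 1 ^ 2) S.domain) : KZ.IsGeodesicPolytope 1 S.domain := by
  refine ⟨3, ![true, true, false], ![![1, 0], ![1, 0], ![0, 0]], ![-1, 1, 1], ![1, -1, 1], ?_, ?_, ?_, ?_, ?_, ?_⟩
  · intro i l
    fin_cases i <;> fin_cases l <;> simp [isAlgebraic_one, isAlgebraic_zero]
  · intro i
    fin_cases i <;> simp [isAlgebraic_one, isAlgebraic_one.neg]
  · intro i
    fin_cases i <;> simp
  · intro i
    fin_cases i <;> rfl
  · rw [hS]
    ext p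
    simp only [mem_setOf_eq]
    constructor
    · rintro ⟨h1, h2, h3, h4⟩
      refine ⟨by simpa [Fin.last] using h3, fun i => ?_⟩
      fin_cases i <;> simp [Fin.sum_univ_two] <;> nlinarith
    · rintro ⟨h3, hall⟩
      have h1 := hall 0
      have h2 := hall 1
      have h4 := hall 2
      simp [Fin.sum_univ_two] at h1 h2 h4
      exact ⟨by linarith, by linarith, by simpa [Fin.last] using h3, by nlinarith⟩
  · have hdens : (KZ.hypDensity 1) = fun p : Fin 2 → ℝ => 1 / p 1 ^ 2 := by
      funext p
      simp [KZ.hypDensity, Fin.last]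
    rw [hdens]
    exact S.integrableOn.congr_fun hSi (KZ.IntegralRep.measurableSet_domain_holds S)

/-- **`π` ACROSS GEOMETRIES**: an integrand-`1` representation of the area of the open unit disc and a representation
`[{−1<x<1, t>0, x²+t²>1}, t⁻²]` of the area of the ideal hyperbolic triangle `(−1, 1, ∞)` are KZ-equivalent — both lie in the
weight-one envelope, both have value `π`, and the envelope theorem (`bakerEnvelope_inf_ker_le_relations`) applies.
[cite: KontsevichZagier2001, §1.1 eq. (1)] -/
theorem disc_sub_idealTriangle_mem_relations (D : KZ.IntegralRep 2) (hD : D.domain = {p | p 0 ^ 2 + p 1 ^ 2 < 1})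
    (hD1 : ∀ p ∈ D.domain, D.integrand p = 1) (S : KZ.IntegralRep 2)
    (hS : S.domain = {p | -1 < p 0 ∧ p 0 < 1 ∧ 0 < p 1 ∧ 1 < (p 0 - 0) ^ 2 + p 1 ^ 2})
    (hSi : EqOn S.integrand (fun p => 1 / p 1 ^ 2) S.domain) : KZ.of D - KZ.of S ∈ KZ.relations := by
  classical
  have hSval : S.value = Real.pi := by
    set V : ℝ → ℝ → ℝ → ℝ → Set (Fin 2 → ℝ) := fun α β a c =>
      {p | α < p 0 ∧ p 0 < β ∧ 0 < p 1 ∧ c < (p 0 - a) ^ 2 + p 1 ^ 2} with hVdef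
    have hV : ∀ α β a c, V α β a c = {p | α < p 0 ∧ p 0 < β ∧ 0 < p 1 ∧ c < (p 0 - a) ^ 2 + p 1 ^ 2} :=
      fun _ _ _ _ => rfl
    rw [(stub_vPiece V hV).2 (-1) le_rfl (by norm_num) S (by rw [hS, hV]) hSi, Real.arccos_neg_one]
  have hri : EqOn S.integrand (KZ.hypDensity 1) S.domain := fun p hp => by
    rw [hSi hp]
    simp [KZ.hypDensity, Fin.last]
  refine bakerEnvelope_inf_ker_le_relations (AddSubgroup.mem_inf.mpr ⟨?_, sub_mem ?_ ?_⟩)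
  · rw [AddMonoidHom.mem_ker, map_sub, KZ.eval_of, KZ.eval_of, value_openDisc D hD hD1, hSval, sub_self]
  · refine AddSubgroup.subset_closure (Or.inl (Or.inr ?_))
    refine ⟨1, 0, D, fun j l => ?_, fun _ => isAlgebraic_zero, by simp, ?_, hD1, rfl⟩
    · rw [Matrix.one_apply]
      split_ifs
      · exact isAlgebraic_one
      · exact isAlgebraic_zero
    · rw [hD]
      ext p
      simp [Matrix.one_mulVec]
  · refine AddSubgroup.subset_closure (Or.inl (Or.inl (Or.inl (Or.inr ?_))))
    exact ⟨S, isGeodesicPolytope_idealTriangle S hS hSi, hri, rfl⟩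

/-! ## The residue, v7 -/

/-- **THE RESIDUE, v7 — the crux is EQUIVALENT to the Moser form of Conjecture 1 modulo the tetrahedral value-relators, the
Bloch–Wigner rung, the weight-one envelope and the affine sector** (⇒: the crux is the kernel form modulo the tetrahedral
closure, which lies below the v7 oracle; ⇐: the oracle-generic transfers `stub_cubeDensityTransfer`, `stub_valueOneOfOrbit`,
`stub_kernelOfValueOne` of lead c4, then `rungTwo_le`, `bakerEnvelope_inf_ker_le_relations` and
`closure_affineOrbit_le_relations` absorb the oracle's proved parts). The right-hand side is the registered remainder
`stub_moserModEnvelope` of skeleton v7: crux-equivalent, summit-strength (Disproof §1), not a proof target.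
[cite: KontsevichZagier2001, §1.2 Conjecture 1] -/
theorem offTetraSectorKernel_iff_moserModEnvelope :
    Summit.KontsevichZagierPeriods.KontsevichZagierPeriods.Theses.HyperbolicBloch.OffTetraSectorKernel ↔
    (∀ (T : ℂ → Set (Fin 3 → ℝ)), (∀ z, T z = {p | 0 < p 1 ∧ z.re * p 1 < z.im * p 0 ∧
      z.im * (p 0 - 1) < (z.re - 1) * p 1 ∧ 0 < p 2 ∧
      0 < z.im * (p 0 ^ 2 + p 1 ^ 2 + p 2 ^ 2 - p 0) + (z.re - Complex.normSq z) * p 1}) →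
    ∀ (d : ℕ) (G Q : KZ.IntegralRep (d + 1)), G.domain = KZ.cube (d + 1) →
      (∀ x ∈ G.domain, 0 ≤ G.integrand x) → Q.domain = KZ.cube (d + 1) →
      (∀ x ∈ Q.domain, Q.integrand x = 1) → G.value = 1 →
      KZ.of G - KZ.of Q ∈ KZ.relations ⊔ (AddSubgroup.closure {d : KZ.FormalRep | ∃ ρ : ℂ → KZ.IntegralRep 3,
          (∀ z, IsAlgebraic ℚ z → 0 < z.im → (ρ z).domain = T z ∧
            Set.EqOn (ρ z).integrand (fun p => 1 / p 2 ^ 3) (T z)) ∧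
          ∃ (k : ℕ) (z : Fin k → ℂ) (n : Fin k → ℤ), (∀ i, IsAlgebraic ℚ (z i)) ∧ (∀ i, 0 < (z i).im) ∧
            ∑ i, (n i : ℝ) * (ρ (z i)).value = 0 ∧ d = ∑ i, n i • KZ.of (ρ (z i))} ⊔
        AddSubgroup.closure (KZ.rungRelators 2) ⊔
        (KZ.eval.ker ⊓ AddSubgroup.closure
          ({y : KZ.FormalRep | ∃ r : KZ.IntegralRep 1, KZ.IsGeodesicPolytope 0 r.domain ∧
              EqOn r.integrand (KZ.hypDensity 0) r.domain ∧ y = KZ.of r} ∪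
            {y | ∃ r : KZ.IntegralRep 2, KZ.IsGeodesicPolytope 1 r.domain ∧
              EqOn r.integrand (KZ.hypDensity 1) r.domain ∧ y = KZ.of r} ∪
            {y | ∃ (d : ℕ) (A : Matrix (Fin d) (Fin d) ℝ) (b : Fin d → ℝ) (r : KZ.IntegralRep d),
              (∀ j l, IsAlgebraic ℚ (A j l)) ∧ (∀ j, IsAlgebraic ℚ (b j)) ∧ A.det ≠ 0 ∧
              r.domain = (fun x => A.mulVec x + b) '' {x | (∀ i, 0 < x i) ∧ ∑ i, x i < 1} ∧
              (∀ x ∈ r.domain, r.integrand x = 1) ∧ y = KZ.of r} ∪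
            {y | ∃ (A : Matrix (Fin 2) (Fin 2) ℝ) (b : Fin 2 → ℝ) (r : KZ.IntegralRep 2),
              (∀ j l, IsAlgebraic ℚ (A j l)) ∧ (∀ j, IsAlgebraic ℚ (b j)) ∧ A.det ≠ 0 ∧
              r.domain = (fun x => A.mulVec x + b) '' {p | p 0 ^ 2 + p 1 ^ 2 < 1} ∧
              (∀ x ∈ r.domain, r.integrand x = 1) ∧ y = KZ.of r} ∪
            {y | ∃ (m : ℕ) (N : KZ.IntegralRep m), m ≤ 1 ∧ N.IsRational ∧ y = KZ.of N})) ⊔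
        AddSubgroup.closure {c : KZ.FormalRep | ∃ (d k : ℕ) (B : Set (Fin d → ℝ))
          (A : Fin k → Matrix (Fin d) (Fin d) ℝ) (b : Fin k → Fin d → ℝ) (m : Fin k → ℤ)
          (r : Fin k → KZ.IntegralRep d), Literature.ModelTheory.ExponentialFields.IsSemialgebraic ℚ B ∧
          volume B ≠ ⊤ ∧ (∀ i j l, IsAlgebraic ℚ (A i j l)) ∧ (∀ i j, IsAlgebraic ℚ (b i j)) ∧
          (∀ i, (A i).det ≠ 0) ∧ (∀ i, (r i).domain = (fun x => (A i).mulVec x + b i) '' B) ∧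
          (∀ i, ∀ x ∈ (r i).domain, (r i).integrand x = 1) ∧ ∑ i, (m i : ℝ) * (r i).value = 0 ∧
          c = ∑ i, m i • KZ.of (r i)}) ) := by
  constructor
  · intro hO T hT d G Q _ _ hQ hQ1 hGv
    have h : KZ.of G - KZ.of Q ∈ KZ.relations ⊔ _ :=
      hO T hT (KZ.of G - KZ.of Q) (by rw [map_sub, KZ.eval_of, KZ.eval_of, hGv, res_value_cubeRep Q hQ hQ1, sub_self])
    exact sup_le_sup_left (le_sup_left.trans (le_sup_left.trans le_sup_left)) KZ.relations h
  · intro hrem T hT c hc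
    have hker := stub_kernelOfValueOne _ (fun d G Q hQ hQ1 hGv =>
      stub_valueOneOfOrbit _ d (fun K Q' hKc _ hK1 hQ' hQ'1 hKv =>
        stub_cubeDensityTransfer _ d (fun G' Q'' hG' hG'0 hQ'' hQ''1 hG'v =>
          hrem T hT d G' Q'' hG' hG'0 hQ'' hQ''1 hG'v) K Q' hKc hK1 hQ' hQ'1 hKv)
        G Q hQ hQ1 hGv) c hc
    exact sup_le le_sup_left (sup_le (sup_le (sup_le le_sup_right (rungTwo_le T hT))
      (bakerEnvelope_inf_ker_le_relations.trans le_sup_left))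
      (closure_affineOrbit_le_relations.trans le_sup_left)) hker

/-! ## Equal measure ⇒ equivalent, across the weight-one envelope (appended, lead c5) -/

/-- **EQUAL MEASURE ⇒ KZ-EQUIVALENT, ACROSS THE WEIGHT-ONE ENVELOPE** (Hilbert's third problem — hyperbolic lengths and areas,
Euclidean `ℚ̄`-simplex volumes, ellipse areas, rational one-dimensional integrals — jointly, inside Kontsevich–Zagier's
calculus): two representations whose classes lie in the weight-one envelope and whose values agree are KZ-equivalent
(two-term instance of `bakerEnvelope_inf_ker_le_relations`; Baker's theorem decides the mixed value relation).
[cite: Baker1975, Theorem 2.1] -/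
theorem equivalent_of_value_eq_of_mem_envelope : ∀ {n m : ℕ} (r : KZ.IntegralRep n) (r' : KZ.IntegralRep m),
    KZ.of r ∈ AddSubgroup.closure
      ({y : KZ.FormalRep | ∃ r : KZ.IntegralRep 1, KZ.IsGeodesicPolytope 0 r.domain ∧
          EqOn r.integrand (KZ.hypDensity 0) r.domain ∧ y = KZ.of r} ∪
        {y | ∃ r : KZ.IntegralRep 2, KZ.IsGeodesicPolytope 1 r.domain ∧
          EqOn r.integrand (KZ.hypDensity 1) r.domain ∧ y = KZ.of r} ∪
        {y | ∃ (d : ℕ) (A : Matrix (Fin d) (Fin d) ℝ) (b : Fin d → ℝ) (r : KZ.IntegralRep d),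
          (∀ j l, IsAlgebraic ℚ (A j l)) ∧ (∀ j, IsAlgebraic ℚ (b j)) ∧ A.det ≠ 0 ∧
          r.domain = (fun x => A.mulVec x + b) '' {x | (∀ i, 0 < x i) ∧ ∑ i, x i < 1} ∧
          (∀ x ∈ r.domain, r.integrand x = 1) ∧ y = KZ.of r} ∪
        {y | ∃ (A : Matrix (Fin 2) (Fin 2) ℝ) (b : Fin 2 → ℝ) (r : KZ.IntegralRep 2),
          (∀ j l, IsAlgebraic ℚ (A j l)) ∧ (∀ j, IsAlgebraic ℚ (b j)) ∧ A.det ≠ 0 ∧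
          r.domain = (fun x => A.mulVec x + b) '' {p | p 0 ^ 2 + p 1 ^ 2 < 1} ∧
          (∀ x ∈ r.domain, r.integrand x = 1) ∧ y = KZ.of r} ∪
        {y | ∃ (m : ℕ) (N : KZ.IntegralRep m), m ≤ 1 ∧ N.IsRational ∧ y = KZ.of N}) →
    KZ.of r' ∈ AddSubgroup.closure
      ({y : KZ.FormalRep | ∃ r : KZ.IntegralRep 1, KZ.IsGeodesicPolytope 0 r.domain ∧
          EqOn r.integrand (KZ.hypDensity 0) r.domain ∧ y = KZ.of r} ∪
        {y | ∃ r : KZ.IntegralRep 2, KZ.IsGeodesicPolytope 1 r.domain ∧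
          EqOn r.integrand (KZ.hypDensity 1) r.domain ∧ y = KZ.of r} ∪
        {y | ∃ (d : ℕ) (A : Matrix (Fin d) (Fin d) ℝ) (b : Fin d → ℝ) (r : KZ.IntegralRep d),
          (∀ j l, IsAlgebraic ℚ (A j l)) ∧ (∀ j, IsAlgebraic ℚ (b j)) ∧ A.det ≠ 0 ∧
          r.domain = (fun x => A.mulVec x + b) '' {x | (∀ i, 0 < x i) ∧ ∑ i, x i < 1} ∧
          (∀ x ∈ r.domain, r.integrand x = 1) ∧ y = KZ.of r} ∪
        {y | ∃ (A : Matrix (Fin 2) (Fin 2) ℝ) (b : Fin 2 → ℝ) (r : KZ.IntegralRep 2),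
          (∀ j l, IsAlgebraic ℚ (A j l)) ∧ (∀ j, IsAlgebraic ℚ (b j)) ∧ A.det ≠ 0 ∧
          r.domain = (fun x => A.mulVec x + b) '' {p | p 0 ^ 2 + p 1 ^ 2 < 1} ∧
          (∀ x ∈ r.domain, r.integrand x = 1) ∧ y = KZ.of r} ∪
        {y | ∃ (m : ℕ) (N : KZ.IntegralRep m), m ≤ 1 ∧ N.IsRational ∧ y = KZ.of N}) →
    r.value = r'.value → KZ.Equivalent r r' :=
  fun r r' hr hr' hv => bakerEnvelope_inf_ker_le_relations (AddSubgroup.mem_inf.mpr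
    ⟨by rw [AddMonoidHom.mem_ker, map_sub, KZ.eval_of, KZ.eval_of, hv, sub_self], sub_mem hr hr'⟩)

end Summit.KontsevichZagierPeriods.HyperbolicBloch.OffTetraSectorKernel

end
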